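import Summits.CriticalPhenomena.CardyFormulaZ2.Theorems.CardySusyWardParafermionFamiliesToSLESixFluxPropagationLattice
import Summits.CriticalPhenomena.CardyFormulaZ2.Theorems.CardySusyWardParafermionFamiliesToSLESixAnchorGeometry
import Summits.CriticalPhenomena.CardyFormulaZ2.Theorems.CardyComplexConeEdgePrecompactShiftStabilityReduction

/-!
# The vanishing side of the boundary first-moment identity (stub `stub_totalSmall_of_UIE` of the line
# `strip-anchored-vertex-normalisation`, skeleton r4, crux stmt-CriticalPhenomena-10814), I: the boundary layer

Helper file 1/2 for the registered stub `stub_totalSmall_of_UIE` (`…TotalSmall.lean`): under the uniform inner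
envelope, along a discretisation family of the anchor square `anchorDomain = {|x+y| < 2, |x-y| < 2}` on which the
spin-`1/3` vertex observable vanishes on compacts, the total `totalVertexSum (Λ δ) δ = Σ_{p random} vertexObs`
over the RANDOM both-faces-inner medial vertices is `o(δ^{-5/3})`. This file carries the per-vertex and counting
inputs of the boundary layer, on the lattice diamond `Ω_δ = {|v₀+v₁| ≤ L, |v₀-v₁| ≤ L}` (`L δ < 2 ≤ (L+1) δ`,
`S5.anchor_geometry`) of admissible data `E` on the anchor at mesh `δ`:

* `le_infDist_meshPoint`: a site of diamond radius `max |v₀+v₁| |v₀-v₁|` is at distance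
  `≥ δ (L - max |v₀+v₁| |v₀-v₁|)/2` from `Ωᶜ` (`|Δre| + |Δim| ≤ 2·dist`);
* `norm_vertexObs_le_sum`: at a random vertex `‖vertexObs‖ ≤ Σ_k ‖G(p,k)‖` (the bridge S1
  `stub_vertexCornerBridge_unfolded`, `2cos(π/12) ≥ 1`; a random vertex touches no site of `zdArcB`, so it is
  not an `A`–`B` edge), hence `≤ 4` (`norm_cornerObs_le_one`);
* `norm_vertexObs_le_profile` (registered one-line form `stub_totalSmall_profile`): with the envelope at constant
  `C ≥ 1` on every corner of lattice depth `R ≥ 1`, `‖vertexObs E δ p‖ ≤ 8 C (dep p + 1)^{-1/3}`,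
  `dep p = L - max |v₀+v₁| |v₀-v₁|` (`v = p.1`): for `dep ≥ 4` the four corner sites (within `δ` of the site `p.1`) have depth
  `≥ δ dep/2 - δ ≥ R δ` with `R = ⌊(dep-2)/2⌋ ≥ 1`, `8R ≥ dep + 1`, so `C R^{-1/3} ≤ 2C(dep+1)^{-1/3}` per corner;
  for `dep ≤ 3`, `4 ≤ 8 C · 8^{-1/3}`;
* `card_le_sq`, `card_fiber_le`: the diamond carries `≤ 2(2L+1)²` medial vertices and each depth layer
  `≤ 8(2L+1)` of them (level / column coordinates `(v₀+v₁, v₀-v₁)` are injective).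
All elementary. [folklore]
-/

noncomputable section

namespace Summit.CriticalPhenomena.CardyFormulaZ2.Theorems.ParafermionFamiliesToSLESix.StripAnchored

open MeasureTheory Filter Set Metric Complex
open scoped Topology BigOperators
open Literature.Probability.LatticeModels
open Literature.Probability.RandomPlanarGeometry (DobrushinDomain)
open Literature.Barriers.CriticalPhenomena (medialCornersAt medialVertexOf isCorner_medialCornersAt)
open Summit.CriticalPhenomena.CardyFormulaZ2.Cruxes.EdgePrecompact.QkzStripBoundaryArm (cornerObs norm_cornerObs_le_one)
open S5 (anchorDomain mem_anchorDomain_carrier anchor_level_nonneg)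

namespace TotalSmall


/-! ## Lattice depth in the diamond -/

/-- The DIAMOND RADIUS of a site `v` is `max |v₀ + v₁| |v₀ - v₁|` (level / column sup-norm) and its lattice DEPTH
in the diamond of size `L` is the natural number `(L - max |v₀ + v₁| |v₀ - v₁|).toNat`; in the diamond the depth,
cast back to `ℤ`, is `L - max |v₀ + v₁| |v₀ - v₁|`. [folklore] -/
theorem cast_dep {L : ℤ} {v : Site 2} (hv : |v 0 + v 1| ≤ L ∧ |v 0 - v 1| ≤ L) :
    (((L - max |v 0 + v 1| |v 0 - v 1|).toNat : ℕ) : ℤ) = L - max |v 0 + v 1| |v 0 - v 1| := by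
  rw [Int.toNat_of_nonneg]
  omega

/-- **Sites of the diamond are deep in the anchor square**: `δ (L - max |s| |d|) / 2 ≤ dist (δ v, Ωᶜ)`
(`s = v₀ + v₁`, `d = v₀ - v₁`; `|Δre| + |Δim| ≤ 2 dist`, `2 - δ|s| ≥ δ (L - |s|)` as `L δ < 2`). [folklore] -/
theorem le_infDist_meshPoint {δ : ℝ} {L : ℤ} (hδ : 0 < δ) (hLδ : (L : ℝ) * δ < 2) (v : Site 2) :
    δ * ((L : ℝ) - (max |v 0 + v 1| |v 0 - v 1| : ℤ)) / 2 ≤ infDist (meshPoint δ v) anchorDomain.carrierᶜ := by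
  set r : ℤ := max |v 0 + v 1| |v 0 - v 1| with hr
  rw [Metric.le_infDist (S6.compl_carrier_nonempty anchorDomain)]
  intro y hy
  rw [Set.mem_compl_iff, mem_anchorDomain_carrier, not_and_or, not_lt, not_lt] at hy
  have hre : |(meshPoint δ v - y).re| ≤ dist (meshPoint δ v) y := by
    rw [dist_eq_norm]; exact Complex.abs_re_le_norm _
  have him : |(meshPoint δ v - y).im| ≤ dist (meshPoint δ v) y := by
    rw [dist_eq_norm]; exact Complex.abs_im_le_norm _
  simp only [Complex.sub_re, Complex.sub_im, meshPoint_re, meshPoint_im] at hre him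
  rw [abs_le] at hre him
  have hs : ((|v 0 + v 1| : ℤ) : ℝ) ≤ r := by exact_mod_cast le_max_left _ _
  have hd : ((|v 0 - v 1| : ℤ) : ℝ) ≤ r := by exact_mod_cast le_max_right _ _
  push_cast at hs hd
  rw [abs_le] at hs hd
  have h1 : δ * ((v 0 : ℝ) + v 1) ≤ δ * r := mul_le_mul_of_nonneg_left hs.2 hδ.le
  have h2 : δ * -(r : ℝ) ≤ δ * ((v 0 : ℝ) + v 1) := mul_le_mul_of_nonneg_left hs.1 hδ.le
  have h3 : δ * ((v 0 : ℝ) - v 1) ≤ δ * r := mul_le_mul_of_nonneg_left hd.2 hδ.le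
  have h4 : δ * -(r : ℝ) ≤ δ * ((v 0 : ℝ) - v 1) := mul_le_mul_of_nonneg_left hd.1 hδ.le
  rcases hy with hy | hy <;> rcases le_abs'.1 hy with hy | hy <;> linarith

/-- Corner sites of a medial vertex are within `δ` of its site. [folklore] -/
theorem dist_corner_fst_le {δ : ℝ} (hδ : 0 ≤ δ) (p : Site 2 × Fin 2) (k : Fin 4) :
    dist (meshPoint δ p.1) (meshPoint δ (medialCornersAt p.1 p.2 k).1) ≤ δ := by
  have h1 := S6.norm_meshPoint_fst_sub_medialPoint hδ p
  have h2 := S6.norm_corner_sub_medialPoint hδ p k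
  rw [dist_eq_norm]
  have := norm_sub_le_norm_sub_add_norm_sub (meshPoint δ p.1) (medialPoint δ (medialVertexOf p))
    (meshPoint δ (medialCornersAt p.1 p.2 k).1)
  rw [norm_sub_rev (medialPoint δ (medialVertexOf p))] at this
  linarith

/-! ## Powers -/

/-- `8^{-1/3} = 1/2`. [folklore] -/
theorem eight_rpow : (8:ℝ) ^ (-(1:ℝ) / 3) = 1 / 2 := by
  rw [show (8:ℝ) = 2 ^ (3:ℝ) by norm_num, ← Real.rpow_mul (by norm_num)]
  norm_num

/-- Antitonicity of `x ↦ x^{-1/3}` with the constant `8`: `y ≤ 8x ⟹ x^{-1/3} ≤ 2 y^{-1/3}`. [folklore] -/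
theorem rpow_le_two_mul {x y : ℝ} (hy : 0 < y) (hxy : y ≤ 8 * x) :
    x ^ (-(1:ℝ) / 3) ≤ 2 * y ^ (-(1:ℝ) / 3) := by
  have h1 : x ^ (-(1:ℝ) / 3) ≤ (y / 8) ^ (-(1:ℝ) / 3) :=
    Real.rpow_le_rpow_of_nonpos (by positivity) (by linarith) (by norm_num)
  rw [Real.div_rpow hy.le (by norm_num), eight_rpow] at h1
  linarith

/-- `y ≤ 8 ⟹ 1/2 ≤ y^{-1/3}`. [folklore] -/
theorem half_le_rpow {y : ℝ} (hy : 0 < y) (hy8 : y ≤ 8) : 1 / 2 ≤ y ^ (-(1:ℝ) / 3) := by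
  rw [← eight_rpow]
  exact Real.rpow_le_rpow_of_nonpos hy hy8 (by norm_num)

/-! ## Random medial vertices: finiteness, the bridge, the envelope profile -/

variable {E : DiscreteDobrushin} {δ : ℝ} {L : ℤ} {C : ℝ}

/-- The two endpoints of a random medial vertex are sites of `Ω_δ`. [folklore] -/
theorem mem_meshDomain_of_random {p : Site 2 × Fin 2} (hp : IsRandomMV E p) :
    p.1 ∈ meshDomain E.Ω E.δ ∧ p.1 + Pi.single p.2 1 ∈ meshDomain E.Ω E.δ := by
  have h := hp.1
  change s(p.1, p.1 + Pi.single p.2 1) ∈ _ at h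
  rw [SimpleGraph.mem_edgeSet] at h
  exact (discreteDomainGraph_adj_iff.1 h).2

/-- For admissible data the random medial vertices are finitely many. [folklore] -/
theorem finite_random (hE : E.IsZdAdmissible) : {p : Site 2 × Fin 2 | IsRandomMV E p}.Finite := by
  refine ((meshDomain_finite hE.isBounded hE.delta_pos).prod (Set.finite_univ (α := Fin 2))).subset ?_
  rintro ⟨x, i⟩ hp
  exact ⟨(mem_meshDomain_of_random hp).1, Set.mem_univ _⟩

/-- `1 ≤ 2cos(π/12)`. [folklore] -/
theorem one_le_two_mul_cos : 1 ≤ 2 * Real.cos (Real.pi / 12) := by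
  have : Real.cos (Real.pi / 3) ≤ Real.cos (Real.pi / 12) :=
    Real.cos_le_cos_of_nonneg_of_le_pi (by positivity) (by linarith [Real.pi_pos]) (by linarith [Real.pi_pos])
  rw [Real.cos_pi_div_three] at this
  linarith

/-- **The bridge bound**: at a random medial vertex of admissible data, `‖vertexObs‖ ≤ Σ_k ‖G(p,k)‖`
(S1: `2cos(π/12) · vertexObs = Σ_k G`, and `2cos(π/12) ≥ 1`; a random vertex is not an `A`–`B` edge since it
touches no site of the discrete arc `B`). [folklore] -/
theorem norm_vertexObs_le_sum (hE : E.IsZdAdmissible) (hδ : 0 < δ) {p : Site 2 × Fin 2} (hp : IsRandomMV E p) :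
    ‖vertexObs E δ (medialVertexOf p)‖ ≤ ∑ k : Fin 4, ‖G E δ p k‖ := by
  have hAB : medialVertexOf p ∉ E.zdABEdges := fun ⟨_, _, y, hy, hyB⟩ => hp.2.2.1 y hy hyB
  have h2 : ((2 * Real.cos (Real.pi / 12) : ℝ) : ℂ) * vertexObs E δ (medialVertexOf p) = ∑ k : Fin 4, G E δ p k :=
    stub_vertexCornerBridge_unfolded E hE p hAB δ hδ
  have hcos := one_le_two_mul_cos
  calc ‖vertexObs E δ (medialVertexOf p)‖
      ≤ (2 * Real.cos (Real.pi / 12)) * ‖vertexObs E δ (medialVertexOf p)‖ := le_mul_of_one_le_left (norm_nonneg _) hcos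
    _ = ‖((2 * Real.cos (Real.pi / 12) : ℝ) : ℂ) * vertexObs E δ (medialVertexOf p)‖ := by
        rw [norm_mul, Complex.norm_real, Real.norm_of_nonneg (by linarith)]
    _ = ‖∑ k : Fin 4, G E δ p k‖ := by rw [h2]
    _ ≤ ∑ k : Fin 4, ‖G E δ p k‖ := norm_sum_le _ _

/-- The trivial bound `‖vertexObs‖ ≤ 4` at a random medial vertex (`‖cornerObs‖ ≤ 1`). [folklore] -/
theorem norm_vertexObs_le_four (hE : E.IsZdAdmissible) (hδ : 0 < δ) {p : Site 2 × Fin 2} (hp : IsRandomMV E p) :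
    ‖vertexObs E δ (medialVertexOf p)‖ ≤ 4 := by
  refine (norm_vertexObs_le_sum hE hδ hp).trans ?_
  have : ∀ k : Fin 4, ‖G E δ p k‖ ≤ 1 := fun k => norm_cornerObs_le_one E δ _ _
  calc ∑ k : Fin 4, ‖G E δ p k‖ ≤ ∑ _k : Fin 4, (1:ℝ) := Finset.sum_le_sum fun k _ => this k
    _ = 4 := by simp

/-- **The envelope profile at a random medial vertex.** On the lattice diamond of size `L` (`L δ < 2`) of
admissible data on the anchor square, with the uniform inner envelope at constant `C ≥ 1`:
`‖vertexObs E δ p‖ ≤ 8 C (dep p + 1)^{-1/3}`, `dep p = L - max |s| |d|` the depth of the site `p.1`. For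
`dep p ≥ 4` the four corner sites are at distance `≥ δ dep/2 - δ ≥ R δ` from `Ωᶜ` with `R = ⌊(dep - 2)/2⌋ ≥ 1`,
`8R ≥ dep + 1`, so each corner observable is `≤ C R^{-1/3} ≤ 2C (dep+1)^{-1/3}`; for `dep p ≤ 3` the trivial
bound `4 ≤ 8C · 8^{-1/3}` suffices. [folklore] -/
theorem norm_vertexObs_le_profile (hE : E.IsZdAdmissible) (hδ : 0 < δ) (hLδ : (L : ℝ) * δ < 2) (hC : 1 ≤ C)
    (hUIE : ∀ (v f : Site 2), IsCorner v f → ∀ R : ℕ, 1 ≤ R →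
      (R : ℝ) * δ ≤ infDist (meshPoint δ v) anchorDomain.carrierᶜ → ‖cornerObs E δ v f‖ ≤ C * (R : ℝ) ^ (-(1:ℝ) / 3))
    {p : Site 2 × Fin 2} (hp : IsRandomMV E p) (hp1 : |p.1 0 + p.1 1| ≤ L ∧ |p.1 0 - p.1 1| ≤ L) :
    ‖vertexObs E δ (medialVertexOf p)‖ ≤
      8 * C * (((L - max |p.1 0 + p.1 1| |p.1 0 - p.1 1|).toNat + 1 : ℕ) : ℝ) ^ (-(1:ℝ) / 3) := by
  set n : ℕ := (L - max |p.1 0 + p.1 1| |p.1 0 - p.1 1|).toNat with hn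
  have hncast : ((n : ℕ) : ℝ) = (L : ℝ) - (max |p.1 0 + p.1 1| |p.1 0 - p.1 1| : ℤ) := by
    have := cast_dep hp1; rw [← hn] at this; exact_mod_cast this
  have hn1 : (0:ℝ) < ((n + 1 : ℕ) : ℝ) := by positivity
  by_cases h4 : 4 ≤ n
  · -- deep vertices: the envelope at depth `R = (n - 2) / 2`
    set R : ℕ := (n - 2) / 2 with hR
    have hR1 : 1 ≤ R := by omega
    have h8R : n + 1 ≤ 8 * R := by omega
    have h2R : 2 * R + 2 ≤ n := by omega
    have h2R' : 2 * (R : ℝ) + 2 ≤ n := by exact_mod_cast h2R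
    have h8R' : ((n + 1 : ℕ) : ℝ) ≤ 8 * (R : ℝ) := by exact_mod_cast h8R
    have hdepth : ∀ k : Fin 4, (R : ℝ) * δ ≤ infDist (meshPoint δ (medialCornersAt p.1 p.2 k).1) anchorDomain.carrierᶜ := by
      intro k
      have h1 := le_infDist_meshPoint hδ hLδ p.1
      have h2 := Metric.infDist_le_infDist_add_dist (x := meshPoint δ p.1)
        (y := meshPoint δ (medialCornersAt p.1 p.2 k).1) (s := anchorDomain.carrierᶜ)
      have h3 := dist_corner_fst_le hδ.le p k
      rw [← hncast] at h1
      nlinarith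
    have hG : ∀ k : Fin 4, ‖G E δ p k‖ ≤ 2 * C * ((n + 1 : ℕ) : ℝ) ^ (-(1:ℝ) / 3) := by
      intro k
      have h1 : ‖G E δ p k‖ ≤ C * (R : ℝ) ^ (-(1:ℝ) / 3) :=
        hUIE _ _ (isCorner_medialCornersAt p.1 p.2 k) R hR1 (hdepth k)
      have h2 : (R : ℝ) ^ (-(1:ℝ) / 3) ≤ 2 * ((n + 1 : ℕ) : ℝ) ^ (-(1:ℝ) / 3) := rpow_le_two_mul hn1 h8R'
      have h3 := mul_le_mul_of_nonneg_left h2 (by linarith : (0:ℝ) ≤ C)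
      linarith
    calc ‖vertexObs E δ (medialVertexOf p)‖ ≤ ∑ k : Fin 4, ‖G E δ p k‖ := norm_vertexObs_le_sum hE hδ hp
      _ ≤ ∑ _k : Fin 4, 2 * C * ((n + 1 : ℕ) : ℝ) ^ (-(1:ℝ) / 3) := Finset.sum_le_sum fun k _ => hG k
      _ = 8 * C * ((n + 1 : ℕ) : ℝ) ^ (-(1:ℝ) / 3) := by
        rw [Finset.sum_const, Finset.card_univ, Fintype.card_fin, nsmul_eq_mul]; push_cast; ring
  · -- shallow vertices: the trivial bound
    have hle8 : ((n + 1 : ℕ) : ℝ) ≤ 8 := by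
      have : n + 1 ≤ 8 := by omega
      exact_mod_cast this
    have hhalf := half_le_rpow hn1 hle8
    have h4' := norm_vertexObs_le_four hE hδ hp
    nlinarith

/-! ## Counting sites of the diamond by level and column -/

/-- Level and column determine the site (and the direction is carried along). [folklore] -/
theorem sdi_injective : Function.Injective (fun p : Site 2 × Fin 2 => ((p.1 0 + p.1 1, p.1 0 - p.1 1), p.2)) := by
  rintro ⟨x, i⟩ ⟨y, j⟩ h
  simp only [Prod.mk.injEq] at h
  obtain ⟨⟨h1, h2⟩, rfl⟩ := h
  refine Prod.ext ?_ rfl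
  funext l
  fin_cases l
  · show x 0 = y 0; omega
  · show x 1 = y 1; omega

/-- `#Icc (-r) r ≤ 2L + 1` for `r ≤ L`, `0 ≤ L` (real-valued). [folklore] -/
theorem card_Icc_neg_le {r L : ℤ} (hr : r ≤ L) (hL : 0 ≤ L) : ((Finset.Icc (-r) r).card : ℝ) ≤ 2 * L + 1 := by
  refine (S6.card_Icc_real_le _ _).trans (max_le (by positivity) ?_)
  have : (r : ℝ) ≤ L := by exact_mod_cast hr
  push_cast; linarith

/-- **The diamond carries at most `2(2L+1)²` medial vertices.** [folklore] -/
theorem card_le_sq {S : Finset (Site 2 × Fin 2)} (hL : 0 ≤ L)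
    (hS : ∀ p ∈ S, |p.1 0 + p.1 1| ≤ L ∧ |p.1 0 - p.1 1| ≤ L) : (S.card : ℝ) ≤ 2 * (2 * L + 1) ^ 2 := by
  have hT := Finset.card_le_card_of_injOn (fun p : Site 2 × Fin 2 => ((p.1 0 + p.1 1, p.1 0 - p.1 1), p.2))
    (s := S) (t := (Finset.Icc (-L) L ×ˢ Finset.Icc (-L) L) ×ˢ (Finset.univ : Finset (Fin 2)))
    (fun p hp => by
      have h := hS p hp
      rw [abs_le, abs_le] at h
      simp only [Finset.coe_product, Finset.coe_Icc, Finset.coe_univ, Set.mem_prod, Set.mem_Icc, Set.mem_univ,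
        and_true]
      omega)
    (sdi_injective.injOn)
  rw [Finset.card_product, Finset.card_product, Finset.card_univ, Fintype.card_fin] at hT
  have h1 := card_Icc_neg_le le_rfl hL
  have hT' : (S.card : ℝ) ≤ ((Finset.Icc (-L) L).card : ℝ) * ((Finset.Icc (-L) L).card : ℝ) * 2 := by
    exact_mod_cast hT
  nlinarith [Nat.cast_nonneg (α := ℝ) (Finset.Icc (-L) L).card]

/-- **Each depth layer of the diamond carries at most `8(2L+1)` medial vertices**: a site of diamond radius
`r` has its level in `{r, -r}` or its column in `{r, -r}`. [folklore] -/
theorem card_fiber_le {S : Finset (Site 2 × Fin 2)} (hL : 0 ≤ L)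
    (hS : ∀ p ∈ S, |p.1 0 + p.1 1| ≤ L ∧ |p.1 0 - p.1 1| ≤ L) (n : ℕ) :
    (((S.filter (fun p => (L - max |p.1 0 + p.1 1| |p.1 0 - p.1 1|).toNat = n)).card : ℝ) ≤ 8 * (2 * L + 1)) := by
  classical
  set r : ℤ := L - n with hr
  have hrL : r ≤ L := by rw [hr]; linarith [(Nat.cast_nonneg n : (0:ℤ) ≤ n)]
  set T : Finset (ℤ × ℤ) := ({r, -r} ×ˢ Finset.Icc (-r) r) ∪ (Finset.Icc (-r) r ×ˢ {r, -r}) with hTdef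
  have hT := Finset.card_le_card_of_injOn (fun p : Site 2 × Fin 2 => ((p.1 0 + p.1 1, p.1 0 - p.1 1), p.2))
    (s := S.filter (fun p => (L - max |p.1 0 + p.1 1| |p.1 0 - p.1 1|).toNat = n)) (t := T ×ˢ (Finset.univ : Finset (Fin 2)))
    (fun p hp => by
      rw [Finset.coe_filter] at hp
      obtain ⟨hpS, hpn⟩ := hp
      have h := hS p hpS
      have hlev : max |p.1 0 + p.1 1| |p.1 0 - p.1 1| = r := by
        have := cast_dep h; rw [hpn] at this; rw [hr]; linarith
      simp only [hTdef, Finset.coe_product, Finset.coe_univ, Set.mem_prod, Set.mem_univ, and_true, Finset.coe_union,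
        Finset.coe_insert, Finset.coe_singleton, Finset.coe_Icc, Set.mem_union, Set.mem_insert_iff,
        Set.mem_singleton_iff, Set.mem_Icc]
      rw [abs_le, abs_le] at h
      rcases max_eq_iff.1 hlev with ⟨h1, h2⟩ | ⟨h1, h2⟩
      · left
        rw [abs_le] at h2
        rcases (abs_eq (hlev ▸ le_max_of_le_left (abs_nonneg _))).1 h1 with h1 | h1
        · exact ⟨Or.inl h1, by omega, by omega⟩
        · exact ⟨Or.inr h1, by omega, by omega⟩
      · right
        rw [abs_le] at h2
        rcases (abs_eq (hlev ▸ le_max_of_le_right (abs_nonneg _))).1 h1 with h1 | h1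
        · exact ⟨⟨by omega, by omega⟩, Or.inl h1⟩
        · exact ⟨⟨by omega, by omega⟩, Or.inr h1⟩)
    (sdi_injective.injOn)
  rw [Finset.card_product, Finset.card_univ, Fintype.card_fin] at hT
  have h1 := card_Icc_neg_le hrL hL
  have h2 : (({r, -r} : Finset ℤ).card : ℝ) ≤ 2 := by exact_mod_cast Finset.card_le_two
  have hTc : (T.card : ℝ) ≤ 4 * (2 * L + 1) := by
    have hu := Finset.card_union_le ({r, -r} ×ˢ Finset.Icc (-r) r) (Finset.Icc (-r) r ×ˢ ({r, -r} : Finset ℤ))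
    rw [Finset.card_product, Finset.card_product] at hu
    have hu' : (T.card : ℝ) ≤ (({r, -r} : Finset ℤ).card : ℝ) * (Finset.Icc (-r) r).card +
        ((Finset.Icc (-r) r).card : ℝ) * ({r, -r} : Finset ℤ).card := by rw [hTdef]; exact_mod_cast hu
    nlinarith [Nat.cast_nonneg (α := ℝ) (Finset.Icc (-r) r).card, Nat.cast_nonneg (α := ℝ) ({r, -r} : Finset ℤ).card]
  have hT' : (((S.filter (fun p => (L - max |p.1 0 + p.1 1| |p.1 0 - p.1 1|).toNat = n)).card : ℕ) : ℝ) ≤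
      (T.card : ℝ) * 2 := by exact_mod_cast hT
  linarith

end TotalSmall

open TotalSmall in
/-- **Registered one-line form `stub_totalSmall_profile`** (sub-goal of stmt-CriticalPhenomena-10814 carried by this
helper file): the envelope profile of the vertex observable at a random medial vertex of the lattice diamond of
admissible data on the anchor square — `‖vertexObs E δ p‖ ≤ 8 C (L - max |s| |d| + 1)^{-1/3}` (`s = v₀ + v₁`,
`d = v₀ - v₁` for the site `v = p.1`), given the uniform inner envelope at constant `C ≥ 1` on the corners of lattice
depth `≥ 1`. [folklore] -/
theorem stub_totalSmall_profile : ∀ (E : DiscreteDobrushin) (δ C : ℝ) (L : ℤ), E.IsZdAdmissible → 0 < δ → (L : ℝ) * δ < 2 → 1 ≤ C → (∀ (v f : Site 2), IsCorner v f → ∀ R : ℕ, 1 ≤ R → (R : ℝ) * δ ≤ infDist (Literature.Probability.LatticeModels.meshPoint δ v) anchorDomain.carrierᶜ → ‖cornerObs E δ v f‖ ≤ C * (R : ℝ) ^ (-(1:ℝ) / 3)) → ∀ p : Site 2 × Fin 2, IsRandomMV E p → |p.1 0 + p.1 1| ≤ L → |p.1 0 - p.1 1| ≤ L → ‖vertexObs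 E δ (medialVertexOf p)‖ ≤ 8 * C * (((L - max |p.1 0 + p.1 1| |p.1 0 - p.1 1|).toNat + 1 : ℕ) : ℝ) ^ (-(1:ℝ) / 3) :=
  fun _ _ _ _ hE hδ hLδ hC hUIE _ hp hs hd => norm_vertexObs_le_profile hE hδ hLδ hC hUIE hp ⟨hs, hd⟩

end Summit.CriticalPhenomena.CardyFormulaZ2.Theorems.ParafermionFamiliesToSLESix.StripAnchored

end
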